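import Summits.QuantumFields.YangMills.Theorems.FemtoTransferGapSlabRayleigh
import HarnessLib

/-!
# Femto transfer gap — LOG-CONVEXITY OF THE TRANSFER MOMENTS `m_k(ψ) = ⟨ψ, K_β^k ψ⟩` of a physical test function
# (route-independent fixed-lattice spectral algebra; tool for the pinned up-step engines, cruxes 27561 / 27379)

Seat ym-line-fcl-p3 g10 (2026-08-28).  For the zero-flux transfer operator `K_β` of `SU(2)` Wilson theory on `(ℤ/L)³` (`β ≥ 0`) and a
physical test function `ψ`, the moment sequence `m_k = ⟨ψ, K_β^k ψ⟩` (`l2 ψ ((transferApply β)^[k] ψ)`) is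

* non-negative (`moment_nonneg`: `m_{2j} = ‖K^jψ‖²`, `m_{2j+1} = ⟨K^jψ, K_β K^jψ⟩ ≥ 0` by positive semi-definiteness
  `qform_su2Rep_self_nonneg`);
* LOG-CONVEX (`moment_succ_sq_le`: `m_{k+1}² ≤ m_k · m_{k+2}` — odd index from the plain Cauchy–Schwarz inequality `sq_l2_le`, even index
  from the Cauchy–Schwarz inequality of the positive semi-definite transfer form `sq_qform_le`, both after `l2_iterate_iterate`);
* hence (`moment_one_mul_le`, `moment_one_pow_le`) `m_1 · m_{k+1} ≤ m_0 · m_{k+2}` and ★ `m_1^{n+1} ≤ m_0^n · m_{n+1}`: the one-step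
  Rayleigh quotient controls every multi-step autocorrelation from below, `⟨ψ,K^{n}ψ⟩ ≥ ‖ψ‖² (⟨ψ,Kψ⟩/‖ψ‖²)^{n}` (Jensen / spectral
  convexity, proved here WITHOUT the spectral theorem).

Use: the ONE-STEP DOOR of stub `stub_pinnedAutocorrExTI1` of crux `PinnedUnitStepEx` (stmt-QuantumFields-27561, sibling file
`FlatTubeReductionPinnedUnitStepExOneStepDoor.lean`).  HONEST FRAMING: elementary fixed-lattice bookkeeping; R2b1 is a RECORD rung; nothing here
is a step, a crux or a summit.  No definitions, no named facts.
References: M. Reed, B. Simon IV (1978) Thm XIII.1; E. Seiler, LNP 159 (1982) §3.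
-/

set_option autoImplicit false

noncomputable section

open MeasureTheory
open Literature.MathematicalPhysics.QuantumFieldTheory

namespace Summit.QuantumFields.YangMills.Theorems.FemtoTransferGap

variable {L : ℕ} [NeZero L]

/-- Odd moments are transfer forms of an iterate: `⟨ψ, K^{2j+1}ψ⟩ = ⟨K^jψ, K_β K^jψ⟩`. [folklore] -/
theorem moment_odd_eq_qform (β : ℝ) {ψ : GaugeConfig 3 L SU2 → ℝ} (hψ : IsPhys ψ) (j : ℕ) :
    l2 ψ ((transferApply β)^[2 * j + 1] ψ) =
      qform su2Rep β ((transferApply β)^[j] ψ) ((transferApply β)^[j] ψ) := by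
  rw [qform_eq_l2_transferApply, ← Function.iterate_succ_apply' (transferApply β) j ψ, l2_iterate_iterate β hψ j (j + 1)]
  congr 2
  ring

/-- Even moments are squared norms of an iterate: `⟨ψ, K^{2j}ψ⟩ = ‖K^jψ‖²`. [folklore] -/
theorem moment_even_eq_l2 (β : ℝ) {ψ : GaugeConfig 3 L SU2 → ℝ} (hψ : IsPhys ψ) (j : ℕ) :
    l2 ψ ((transferApply β)^[2 * j] ψ) = l2 ((transferApply β)^[j] ψ) ((transferApply β)^[j] ψ) := by
  rw [l2_iterate_iterate β hψ j j]
  congr 2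
  ring

/-- **Transfer moments are non-negative** (`β ≥ 0`): `0 ≤ ⟨ψ, K_β^k ψ⟩` for physical `ψ`. [cite: ReedSimonIV1978, Thm. XIII.1] -/
theorem moment_nonneg {β : ℝ} (hβ : 0 ≤ β) {ψ : GaugeConfig 3 L SU2 → ℝ} (hψ : IsPhys ψ) (k : ℕ) :
    0 ≤ l2 ψ ((transferApply β)^[k] ψ) := by
  obtain ⟨j, rfl | rfl⟩ := Nat.even_or_odd' k
  · rw [moment_even_eq_l2 β hψ j]
    exact l2_self_nonneg _
  · rw [moment_odd_eq_qform β hψ j]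
    exact qform_su2Rep_self_nonneg hβ (isPhys_iterate_transferApply β hψ j)

/-- **Log-convexity of the transfer moments**: `⟨ψ,K^{k+1}ψ⟩² ≤ ⟨ψ,K^kψ⟩ · ⟨ψ,K^{k+2}ψ⟩` for physical `ψ`, `β ≥ 0` — the odd case
`k + 1 = 2j + 1` is Cauchy–Schwarz for `⟨K^jψ, K^{j+1}ψ⟩`, the even case `k + 1 = 2j + 2` is Cauchy–Schwarz for the positive
semi-definite transfer form, `⟨K^jψ, K_β K^{j+1}ψ⟩² ≤ ⟨K^jψ,K_βK^jψ⟩⟨K^{j+1}ψ,K_βK^{j+1}ψ⟩`. [cite: ReedSimonIV1978, Thm. XIII.1] -/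
theorem moment_succ_sq_le {β : ℝ} (hβ : 0 ≤ β) {ψ : GaugeConfig 3 L SU2 → ℝ} (hψ : IsPhys ψ) (k : ℕ) :
    l2 ψ ((transferApply β)^[k + 1] ψ) ^ 2 ≤
      l2 ψ ((transferApply β)^[k] ψ) * l2 ψ ((transferApply β)^[k + 2] ψ) := by
  have hK : ∀ i, IsPhys ((transferApply β)^[i] ψ) := fun i => isPhys_iterate_transferApply β hψ i
  obtain ⟨j, rfl | rfl⟩ := Nat.even_or_odd' k
  · -- `k = 2j`: the middle moment is `⟨K^jψ, K^{j+1}ψ⟩`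
    have hmid : l2 ψ ((transferApply β)^[2 * j + 1] ψ) =
        l2 ((transferApply β)^[j] ψ) ((transferApply β)^[j + 1] ψ) := by
      rw [l2_iterate_iterate β hψ j (j + 1)]; congr 2; ring
    have hright : l2 ψ ((transferApply β)^[2 * j + 2] ψ) =
        l2 ((transferApply β)^[j + 1] ψ) ((transferApply β)^[j + 1] ψ) := by
      rw [l2_iterate_iterate β hψ (j + 1) (j + 1)]; congr 2; ring
    rw [hmid, moment_even_eq_l2 β hψ j, hright]
    exact sq_l2_le (hK j) (hK (j + 1))
  · -- `k = 2j + 1`: the middle moment is `⟨K^jψ, K_β K^{j+1}ψ⟩`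
    have hmid : l2 ψ ((transferApply β)^[2 * j + 1 + 1] ψ) =
        qform su2Rep β ((transferApply β)^[j] ψ) ((transferApply β)^[j + 1] ψ) := by
      rw [qform_eq_l2_transferApply, ← Function.iterate_succ_apply' (transferApply β) (j + 1) ψ,
        l2_iterate_iterate β hψ j (j + 1 + 1)]
      congr 2; ring
    have hleft : l2 ψ ((transferApply β)^[2 * j + 1] ψ) =
        qform su2Rep β ((transferApply β)^[j] ψ) ((transferApply β)^[j] ψ) := moment_odd_eq_qform β hψ j
    have hright : l2 ψ ((transferApply β)^[2 * j + 1 + 2] ψ) =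
        qform su2Rep β ((transferApply β)^[j + 1] ψ) ((transferApply β)^[j + 1] ψ) := by
      rw [show 2 * j + 1 + 2 = 2 * (j + 1) + 1 by ring]
      exact moment_odd_eq_qform β hψ (j + 1)
    rw [hmid, hleft, hright]
    exact sq_qform_le hβ (hK j) (hK (j + 1))

/-- If the first moment is positive, all moments are positive (log-convexity propagates positivity). [folklore] -/
theorem moment_pos_of_moment_one_pos {β : ℝ} (hβ : 0 ≤ β) {ψ : GaugeConfig 3 L SU2 → ℝ} (hψ : IsPhys ψ)
    (h1 : 0 < l2 ψ ((transferApply β)^[1] ψ)) (k : ℕ) : 0 < l2 ψ ((transferApply β)^[k] ψ) := by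
  -- `P k : 0 < m_k ∧ 0 < m_{k+1}` by induction
  have h0 : 0 < l2 ψ ((transferApply β)^[0] ψ) := by
    have hcs := moment_succ_sq_le hβ hψ 0
    have h2 := moment_nonneg hβ hψ (0 + 2)
    have hm0 := moment_nonneg hβ hψ 0
    rcases hm0.lt_or_eq with hpos | hzero
    · exact hpos
    · exfalso
      rw [← hzero, zero_mul] at hcs
      exact absurd (le_antisymm hcs (sq_nonneg _)) (pow_pos h1 2).ne'
  have step : ∀ i, 0 < l2 ψ ((transferApply β)^[i] ψ) → 0 < l2 ψ ((transferApply β)^[i + 1] ψ) →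
      0 < l2 ψ ((transferApply β)^[i + 2] ψ) := by
    intro i hi hi1
    have hcs := moment_succ_sq_le hβ hψ i
    have h2 := moment_nonneg hβ hψ (i + 2)
    rcases h2.lt_or_eq with hpos | hzero
    · exact hpos
    · exfalso
      rw [← hzero, mul_zero] at hcs
      exact absurd (le_antisymm hcs (sq_nonneg _)) (pow_pos hi1 2).ne'
  have both : ∀ i, 0 < l2 ψ ((transferApply β)^[i] ψ) ∧ 0 < l2 ψ ((transferApply β)^[i + 1] ψ) := by
    intro i
    induction i with
    | zero => exact ⟨h0, h1⟩
    | succ i ih => exact ⟨ih.2, step i ih.1 ih.2⟩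
  exact (both k).1

/-- **Ratio monotonicity**: `⟨ψ,Kψ⟩ · ⟨ψ,K^{k+1}ψ⟩ ≤ ‖ψ‖² · ⟨ψ,K^{k+2}ψ⟩` (the ratios `m_{k+1}/m_k` increase; trivial when `⟨ψ,Kψ⟩ = 0`).
[cite: ReedSimonIV1978, Thm. XIII.1] -/
theorem moment_one_mul_le {β : ℝ} (hβ : 0 ≤ β) {ψ : GaugeConfig 3 L SU2 → ℝ} (hψ : IsPhys ψ) (k : ℕ) :
    l2 ψ ((transferApply β)^[1] ψ) * l2 ψ ((transferApply β)^[k + 1] ψ) ≤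
      l2 ψ ((transferApply β)^[0] ψ) * l2 ψ ((transferApply β)^[k + 2] ψ) := by
  rcases (moment_nonneg hβ hψ 1).lt_or_eq with h1 | h1
  · -- all moments positive: the ratios `r_i = m_{i+1}/m_i` are non-decreasing, so `r_0 ≤ r_{k+1}`
    have hpos : ∀ i, 0 < l2 ψ ((transferApply β)^[i] ψ) := moment_pos_of_moment_one_pos hβ hψ h1
    set m : ℕ → ℝ := fun i => l2 ψ ((transferApply β)^[i] ψ) with hm
    have hr : ∀ i, m (i + 1) / m i ≤ m (i + 2) / m (i + 1) := by
      intro i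
      rw [div_le_div_iff₀ (hpos i) (hpos (i + 1))]
      calc m (i + 1) * m (i + 1) = m (i + 1) ^ 2 := (sq _).symm
        _ ≤ m i * m (i + 2) := moment_succ_sq_le hβ hψ i
        _ = m (i + 2) * m i := mul_comm _ _
    have hmono : Monotone fun i => m (i + 1) / m i := monotone_nat_of_le_succ hr
    have h0k : m (0 + 1) / m 0 ≤ m (k + 1 + 1) / m (k + 1) := hmono (Nat.zero_le (k + 1))
    rw [div_le_div_iff₀ (hpos 0) (hpos (k + 1))] at h0k
    calc m 1 * m (k + 1) = m (0 + 1) * m (k + 1) := rfl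
      _ ≤ m (k + 1 + 1) * m 0 := h0k
      _ = m 0 * m (k + 2) := by rw [mul_comm]
  · rw [← h1, zero_mul]
    exact mul_nonneg (moment_nonneg hβ hψ 0) (moment_nonneg hβ hψ (k + 2))

/-- ★ **The one-step Rayleigh quotient bounds every autocorrelation from below**: `⟨ψ,K_βψ⟩^{n+1} ≤ ‖ψ‖^{2n} · ⟨ψ,K_β^{n+1}ψ⟩` for
physical `ψ` and `β ≥ 0`, i.e. `⟨ψ,K^{n+1}ψ⟩/‖ψ‖² ≥ (⟨ψ,Kψ⟩/‖ψ‖²)^{n+1}` — Jensen's inequality for the spectral measure of `ψ`, obtained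
from log-convexity alone. [cite: ReedSimonIV1978, Thm. XIII.1] -/
theorem moment_one_pow_le {β : ℝ} (hβ : 0 ≤ β) {ψ : GaugeConfig 3 L SU2 → ℝ} (hψ : IsPhys ψ) (n : ℕ) :
    l2 ψ (transferApply β ψ) ^ (n + 1) ≤ l2 ψ ψ ^ n * l2 ψ ((transferApply β)^[n + 1] ψ) := by
  have e1 : l2 ψ (transferApply β ψ) = l2 ψ ((transferApply β)^[1] ψ) := by rw [Function.iterate_one]
  have e0 : l2 ψ ψ = l2 ψ ((transferApply β)^[0] ψ) := by rw [Function.iterate_zero_apply]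
  induction n with
  | zero => simp
  | succ n ih =>
    have hm1 : 0 ≤ l2 ψ (transferApply β ψ) := by rw [e1]; exact moment_nonneg hβ hψ 1
    have hm0 : 0 ≤ l2 ψ ψ := l2_self_nonneg _
    have hstep := moment_one_mul_le hβ hψ n
    rw [← e1, ← e0] at hstep
    calc l2 ψ (transferApply β ψ) ^ (n + 1 + 1)
        = l2 ψ (transferApply β ψ) ^ (n + 1) * l2 ψ (transferApply β ψ) := pow_succ _ _
      _ ≤ (l2 ψ ψ ^ n * l2 ψ ((transferApply β)^[n + 1] ψ)) * l2 ψ (transferApply β ψ) :=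
          mul_le_mul_of_nonneg_right ih hm1
      _ = l2 ψ ψ ^ n * (l2 ψ (transferApply β ψ) * l2 ψ ((transferApply β)^[n + 1] ψ)) := by ring
      _ ≤ l2 ψ ψ ^ n * (l2 ψ ψ * l2 ψ ((transferApply β)^[n + 2] ψ)) :=
          mul_le_mul_of_nonneg_left hstep (pow_nonneg hm0 n)
      _ = l2 ψ ψ ^ (n + 1) * l2 ψ ((transferApply β)^[n + 1 + 1] ψ) := by ring

end Summit.QuantumFields.YangMills.Theorems.FemtoTransferGap

end
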